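import Mathlib.Data.Fintype.BigOperators
import Mathlib.Data.Fintype.Pi
import Mathlib.Data.Fintype.Prod
import Mathlib.Logic.Equiv.Fin.Basic
import Mathlib.Algebra.BigOperators.Fin
import Mathlib.Algebra.Order.BigOperators.Group.Finset
import HarnessLib

/-!
# Target-collision resistance under concatenation and under chaining (input-length extension): combinatorial core

Topic `Literature/Computability/Cryptography`; fifth file of the "one-way functions ⇒ universal one-way hash
functions" line (Rompel 1990 = Goldreich 2004, Thm. 6.4.29, via Haitner–Holenstein–Reingold–Vadhan–Wee,
*Inaccessible Entropy II*, Theory of Computing 16(8), 2020; plan in `InaccessibleEntropyPrefixHash.lean`).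
Step 5 of the proof of HHRVW's Theorem 5.1 removes the non-uniform advice (an estimate `k` of the real
entropy) by running the construction for all grid values of `k` and **concatenating** the resulting families
on the same input — which is sound because a designated collision for the concatenation is one for every
component, in particular for the (unknown) good one — after first **extending the input length** of each
candidate by chaining with independent keys (Lemma 5.7; the concatenation of `κ` barely-shrinking families
is not shrinking otherwise). This file proves the two counting facts behind these combiners, for two-stage
(target-collision) adversaries given as functions of their coins — first stage `x₀(ρ)`, second stage
`A(key, ρ; ω)` — at one input length, with explicit factors:

* `card_filter_plant` — planting a challenge key at one coordinate of a self-chosen key vector re-indexes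
  bijectively: `#{(y, ys, w) : Q(ys[i ↦ y], w)} = |Y| · #{(ys, w) : Q(ys, w)}`;
* `concatFam`, `card_concat_success_mul_le` — against the concatenation `(G_j(ys j, x))_j`, for every
  component `j` the planted adversary against `G_j` succeeds on at least `|Y| · #{concatenation successes}`
  coin tuples (i.e. with at least the same probability);
* `chainState`, `chainOut` (the chain `st₀ = s₀`, `st_{r+1} = pack(G_{ys r}(st_r), c_r)`, value
  `G_{ys R}(st_R)`), `chainState_congr` (level `r` uses only the keys below `r`), `exists_level_collision`
  (a chain collision is a collision at the last level where the states differ; `pack` injective) and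
  `card_chain_success_mul_le` — summed over the `R+1` levels, the level-planting adversaries against `G`
  succeed on at least `|Y| · #{chain successes}` coin tuples (i.e. a uniformly chosen level loses a factor
  `R+1`), the derived first stage being legitimate because the target state does not depend on the
  challenge key.

All statements proved; no named facts; no machines (the uniform machines realising these adversaries and
the asymptotics belong to the machine-level files).

## References

* I. Haitner, T. Holenstein, O. Reingold, S. Vadhan, H. Wee, *Inaccessible Entropy II: IE Functions and
  Universal One-Way Hashing*, Theory of Computing 16(8) (2020), proof of Thm. 5.1, Step 5 (pp. 31–32), and
  Lemma 5.7 (increasing the input length; after Shoup 2000, Naor–Yung 1989, Bellare–Rogaway 1997).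
* O. Goldreich, *Foundations of Cryptography II*, CUP 2004, §6.4.3.2, Construction 6.4.22 and Prop. 6.4.23
  (composition of length-restricted UOWHFs with independent keys; the level-guessing reduction).
* M. Naor, M. Yung, *Universal one-way hash functions and their cryptographic applications*, STOC 1989, §2.
-/

namespace Literature.Computability.Cryptography

namespace HHRVW

open Finset

/-! ### Planting a challenge key at one coordinate of a key vector -/

section Plant

variable {I Y W : Type*} [Fintype I] [DecidableEq I] [Fintype Y] [Fintype W]

/-- **Planting count.** For a predicate `Q` of a key vector and further data, the tuples `(y, ys, w)` with
`Q (ys[i ↦ y]) w` are exactly `|Y|` times as many as the pairs `(ys, w)` with `Q ys w` (the extra factor is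
the overwritten coordinate `ys i`): `(y, ys) ↦ (ys[i ↦ y], ys i)` is a bijection. This is the counting
behind "plant the challenge key at a uniform position of a self-chosen key vector".
[cite: HaitnerEtAl2020, proof of Thm. 5.1, Step 5 and Lemma 5.7; Goldreich 2004, Prop. 6.4.23 (proof)] -/
theorem card_filter_plant (i : I) (Q : (I → Y) → W → Prop) [∀ ys w, Decidable (Q ys w)] :
    ((univ : Finset (Y × (I → Y) × W)).filter fun q => Q (Function.update q.2.1 i q.1) q.2.2).card =
      Fintype.card Y * ((univ : Finset ((I → Y) × W)).filter fun p => Q p.1 p.2).card := by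
  classical
  set E : Y × (I → Y) × W ≃ ((I → Y) × W) × Y :=
    { toFun := fun q => ((Function.update q.2.1 i q.1, q.2.2), q.2.1 i)
      invFun := fun p => (p.1.1 i, Function.update p.1.1 i p.2, p.1.2)
      left_inv := fun q => by
        rcases q with ⟨y, ys, w⟩
        simp only [Function.update_self, Function.update_idem, Function.update_eq_self]
      right_inv := fun p => by
        rcases p with ⟨⟨ys, w⟩, b⟩
        simp only [Function.update_self, Function.update_idem, Function.update_eq_self] } with hE
  have hset : ((univ : Finset (Y × (I → Y) × W)).filter fun q => Q (Function.update q.2.1 i q.1) q.2.2) =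
      ((((univ : Finset ((I → Y) × W)).filter fun p => Q p.1 p.2) ×ˢ (univ : Finset Y)).map E.symm.toEmbedding) := by
    ext ⟨y, ys, w⟩
    simp [hE]
  rw [hset, Finset.card_map, Finset.card_product, Finset.card_univ, mul_comm]

end Plant

/-! ### Concatenation of families on the same input -/

section Concat

variable {J Y X O Ρ Ω : Type*} [Fintype J] [DecidableEq J] [Fintype Y] [DecidableEq X] [DecidableEq O]
  [Fintype Ρ] [Fintype Ω]

/-- The concatenated family: key vector `ys`, value `(G_j (ys j) x)_j`. [cite: HaitnerEtAl2020, proof of Thm. 5.1, Step 5 (iii)] -/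
def concatFam (G : J → Y → X → O) (ys : J → Y) (x : X) : J → O := fun j => G j (ys j) x

/-- **A designated collision for the concatenation is one for every component.** For a two-stage adversary
`(x₀, A)` against the concatenated family and any component `j`, the planted adversary against `G_j` — same
first stage; second stage plants the challenge key `y` at position `j` of a key vector `ys` taken from its
coins and runs `A` — satisfies `#{(ys, ρ, ω) : concatenation success} · |Y| ≤ #{(y, ys, ρ, ω) : planted
success at j}` (the factor `|Y|` is the overwritten coordinate `ys j`). [cite: HaitnerEtAl2020, proof of Thm. 5.1, Step 5 (iii)] -/
theorem card_concat_success_mul_le (G : J → Y → X → O) (x₀ : Ρ → X) (A : (J → Y) → Ρ → Ω → X) (j : J) :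
    ((univ : Finset ((J → Y) × Ρ × Ω)).filter fun q =>
        A q.1 q.2.1 q.2.2 ≠ x₀ q.2.1 ∧ concatFam G q.1 (A q.1 q.2.1 q.2.2) = concatFam G q.1 (x₀ q.2.1)).card *
        Fintype.card Y ≤
      ((univ : Finset (Y × (J → Y) × Ρ × Ω)).filter fun q =>
        A (Function.update q.2.1 j q.1) q.2.2.1 q.2.2.2 ≠ x₀ q.2.2.1 ∧
          G j q.1 (A (Function.update q.2.1 j q.1) q.2.2.1 q.2.2.2) = G j q.1 (x₀ q.2.2.1)).card := by
  classical
  set P : (J → Y) → Ρ × Ω → Prop := fun ys w =>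
    A ys w.1 w.2 ≠ x₀ w.1 ∧ G j (ys j) (A ys w.1 w.2) = G j (ys j) (x₀ w.1) with hP
  -- the planted predicate is `P (ys[j ↦ y]) (ρ, r)`
  have hcongr : ((univ : Finset (Y × (J → Y) × Ρ × Ω)).filter fun q =>
        A (Function.update q.2.1 j q.1) q.2.2.1 q.2.2.2 ≠ x₀ q.2.2.1 ∧
          G j q.1 (A (Function.update q.2.1 j q.1) q.2.2.1 q.2.2.2) = G j q.1 (x₀ q.2.2.1)) =
      ((univ : Finset (Y × (J → Y) × Ρ × Ω)).filter fun q => P (Function.update q.2.1 j q.1) q.2.2) := by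
    refine Finset.filter_congr fun q _ => ?_
    simp only [hP, Function.update_self]
  rw [hcongr, card_filter_plant j P]
  rw [mul_comm]
  refine Nat.mul_le_mul_left _ (Finset.card_le_card fun q hq => ?_)
  rw [Finset.mem_filter] at hq ⊢
  refine ⟨Finset.mem_univ _, hq.2.1, ?_⟩
  have := congrFun hq.2.2 j
  simpa [concatFam] using this

end Concat

/-! ### Chaining with independent keys (input-length extension) -/

section Chain

variable {Y S O C : Type*}

/-- The state sequence of the chained hash: `st 0 = s₀`, `st (r+1) = pack (G_{ys r} (st r), cs r)` for `r < R`
(constant afterwards). [cite: HaitnerEtAl2020, Lemma 5.7 (increasing the input length)] -/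
def chainState (G : Y → S → O) (pack : O × C → S) (R : ℕ) (ys : Fin (R + 1) → Y) (s₀ : S) (cs : Fin R → C) : ℕ → S
  | 0 => s₀
  | r + 1 => if h : r < R then pack (G (ys ⟨r, Nat.lt_succ_of_lt h⟩) (chainState G pack R ys s₀ cs r), cs ⟨r, h⟩)
      else chainState G pack R ys s₀ cs r

/-- The chained hash value: the last key applied to the last state, `G_{ys R} (st R)`. Input length
`|S| + R·|C|`, output `|O|`: with `|S| = |O| + |C|` the chain shrinks by `(R+1)·|C|`.
[cite: HaitnerEtAl2020, Lemma 5.7] -/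
def chainOut (G : Y → S → O) (pack : O × C → S) (R : ℕ) (ys : Fin (R + 1) → Y) (p : S × (Fin R → C)) : O :=
  G (ys ⟨R, Nat.lt_succ_self R⟩) (chainState G pack R ys p.1 p.2 R)

variable (G : Y → S → O) (pack : O × C → S) (R : ℕ)

/-- The state at level `r` only depends on the keys below `r`. [cite: HaitnerEtAl2020, Lemma 5.7 (proof)] -/
theorem chainState_congr {ys ys' : Fin (R + 1) → Y} (s₀ : S) (cs : Fin R → C) {r : ℕ}
    (h : ∀ i : Fin (R + 1), (i : ℕ) < r → ys i = ys' i) :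
    chainState G pack R ys s₀ cs r = chainState G pack R ys' s₀ cs r := by
  induction r with
  | zero => rfl
  | succ r ih =>
    have ih' := ih fun i hi => h i (Nat.lt_succ_of_lt hi)
    simp only [chainState]
    split_ifs with hr
    · rw [ih', h ⟨r, Nat.lt_succ_of_lt hr⟩ (Nat.lt_succ_self r)]
    · exact ih'

variable [DecidableEq S]

/-- **A designated collision for the chain yields one at some level.** If two distinct inputs have the
same chained value then at some level `r ≤ R` their states differ while the level-`r` hash values agree
(take the last level at which the states differ; `pack` injective). [cite: HaitnerEtAl2020, Lemma 5.7 (proof); Goldreich 2004, Prop. 6.4.23 (proof sketch)] -/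
theorem exists_level_collision (hpack : Function.Injective pack) (ys : Fin (R + 1) → Y)
    {p p' : S × (Fin R → C)} (hne : p ≠ p') (hout : chainOut G pack R ys p = chainOut G pack R ys p') :
    ∃ r : Fin (R + 1), chainState G pack R ys p.1 p.2 r ≠ chainState G pack R ys p'.1 p'.2 r ∧
      G (ys r) (chainState G pack R ys p.1 p.2 r) = G (ys r) (chainState G pack R ys p'.1 p'.2 r) := by
  classical
  set st := chainState G pack R ys p.1 p.2 with hst
  set st' := chainState G pack R ys p'.1 p'.2 with hst'
  -- the set of levels where the states differ is nonempty
  set D := (Finset.range (R + 1)).filter fun r => st r ≠ st' r with hD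
  have hDne : D.Nonempty := by
    by_cases h0 : p.1 = p'.1
    · -- some chunk differs
      have hcs : p.2 ≠ p'.2 := fun h2 => hne (Prod.ext h0 h2)
      obtain ⟨i, hi⟩ : ∃ i : Fin R, p.2 i ≠ p'.2 i := by
        by_contra hall; push Not at hall; exact hcs (funext hall)
      refine ⟨(i : ℕ) + 1, Finset.mem_filter.2 ⟨Finset.mem_range.2 (by omega), ?_⟩⟩
      intro heq
      simp only [hst, hst', chainState, dif_pos i.isLt] at heq
      have := (Prod.ext_iff.1 (hpack heq)).2
      exact hi (by simpa using this)
    · exact ⟨0, Finset.mem_filter.2 ⟨Finset.mem_range.2 (Nat.succ_pos R), h0⟩⟩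
  -- its maximum is the collision level
  obtain ⟨r, hrD, hrmax⟩ := D.exists_max_image id hDne
  rw [hD, Finset.mem_filter, Finset.mem_range] at hrD
  refine ⟨⟨r, hrD.1⟩, hrD.2, ?_⟩
  by_cases hrR : r = R
  · subst hrR
    exact hout
  · have hrlt : r < R := lt_of_le_of_ne (Nat.lt_succ_iff.1 hrD.1) hrR
    -- level `r+1` is not in `D`
    have hnext : st (r + 1) = st' (r + 1) := by
      by_contra hne'
      have hmem : r + 1 ∈ D := Finset.mem_filter.2 ⟨Finset.mem_range.2 (by omega), hne'⟩
      have := hrmax (r + 1) hmem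
      simp only [id] at this
      omega
    simp only [hst, hst', chainState, dif_pos hrlt] at hnext
    exact (Prod.ext_iff.1 (hpack hnext)).1

variable {Ρ Ω : Type*} [Fintype Y] [Fintype Ρ] [Fintype Ω] [DecidableEq O] [DecidableEq C]

/-- **The level-planting reduction for the chain, counted.** For a two-stage adversary `(x̂₀, Â)` against
the chained family with keys `ys ∈ Y^{R+1}` and a level `r`, the derived adversary against the basic family
`G` — coins `(ys, ρ, ω)`; first stage: the level-`r` state of `x̂₀(ρ)` under `ys` (which only uses the keys
below `r`); second stage on the challenge key `y`: plant `y` at level `r`, run `Â`, answer with the level-`r`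
state of its output — succeeds, summed over the levels, on at least `|Y| · #{(ys, ρ, ω) : (x̂₀, Â) succeeds
against the chain}` tuples `(y, ys, ρ, ω)`: every chain collision is a collision at some level
(`exists_level_collision`), and planting re-indexes `(y, ys) ↦ (ys[r ↦ y], ys r)`.
[cite: HaitnerEtAl2020, Lemma 5.7; Goldreich 2004, Prop. 6.4.23 (proof)] -/
theorem card_chain_success_mul_le (hpack : Function.Injective pack) (x₀ : Ρ → S × (Fin R → C))
    (A : (Fin (R + 1) → Y) → Ρ → Ω → S × (Fin R → C)) :
    ((univ : Finset ((Fin (R + 1) → Y) × Ρ × Ω)).filter fun q =>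
        A q.1 q.2.1 q.2.2 ≠ x₀ q.2.1 ∧ chainOut G pack R q.1 (A q.1 q.2.1 q.2.2) = chainOut G pack R q.1 (x₀ q.2.1)).card *
        Fintype.card Y ≤
      ∑ r : Fin (R + 1), ((univ : Finset (Y × (Fin (R + 1) → Y) × Ρ × Ω)).filter fun q =>
        chainState G pack R (Function.update q.2.1 r q.1) (A (Function.update q.2.1 r q.1) q.2.2.1 q.2.2.2).1
            (A (Function.update q.2.1 r q.1) q.2.2.1 q.2.2.2).2 r ≠
          chainState G pack R q.2.1 (x₀ q.2.2.1).1 (x₀ q.2.2.1).2 r ∧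
        G q.1 (chainState G pack R (Function.update q.2.1 r q.1) (A (Function.update q.2.1 r q.1) q.2.2.1 q.2.2.2).1
            (A (Function.update q.2.1 r q.1) q.2.2.1 q.2.2.2).2 r) =
          G q.1 (chainState G pack R q.2.1 (x₀ q.2.2.1).1 (x₀ q.2.2.1).2 r)).card := by
  classical
  -- the level-`r` collision event for a full key vector
  set E : Fin (R + 1) → (Fin (R + 1) → Y) → Ρ → Ω → Prop := fun r ys ρ ω =>
    chainState G pack R ys (A ys ρ ω).1 (A ys ρ ω).2 r ≠ chainState G pack R ys (x₀ ρ).1 (x₀ ρ).2 r ∧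
      G (ys r) (chainState G pack R ys (A ys ρ ω).1 (A ys ρ ω).2 r) = G (ys r) (chainState G pack R ys (x₀ ρ).1 (x₀ ρ).2 r)
    with hE
  -- Step 1: every chain collision is a level collision
  have hcover : ((univ : Finset ((Fin (R + 1) → Y) × Ρ × Ω)).filter fun q =>
        A q.1 q.2.1 q.2.2 ≠ x₀ q.2.1 ∧ chainOut G pack R q.1 (A q.1 q.2.1 q.2.2) = chainOut G pack R q.1 (x₀ q.2.1)).card ≤
      ∑ r : Fin (R + 1), ((univ : Finset ((Fin (R + 1) → Y) × Ρ × Ω)).filter fun q => E r q.1 q.2.1 q.2.2).card := by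
    rw [Finset.card_filter]
    simp_rw [Finset.card_filter]
    rw [Finset.sum_comm]
    refine Finset.sum_le_sum fun q _ => ?_
    split_ifs with hq
    · obtain ⟨r, hr⟩ := exists_level_collision G pack R hpack q.1 hq.1 hq.2
      calc 1 = (if E r q.1 q.2.1 q.2.2 then 1 else 0) := by rw [if_pos]; exact hr
        _ ≤ ∑ r, (if E r q.1 q.2.1 q.2.2 then 1 else 0) :=
            Finset.single_le_sum (f := fun r => if E r q.1 q.2.1 q.2.2 then 1 else 0) (fun _ _ => Nat.zero_le _)
              (Finset.mem_univ r)
    · exact Nat.zero_le _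
  -- Step 2: planting at level `r` multiplies the level-`r` count by `|Y|`
  have hplant : ∀ r : Fin (R + 1), ((univ : Finset (Y × (Fin (R + 1) → Y) × Ρ × Ω)).filter fun q =>
        chainState G pack R (Function.update q.2.1 r q.1) (A (Function.update q.2.1 r q.1) q.2.2.1 q.2.2.2).1
            (A (Function.update q.2.1 r q.1) q.2.2.1 q.2.2.2).2 r ≠
          chainState G pack R q.2.1 (x₀ q.2.2.1).1 (x₀ q.2.2.1).2 r ∧
        G q.1 (chainState G pack R (Function.update q.2.1 r q.1) (A (Function.update q.2.1 r q.1) q.2.2.1 q.2.2.2).1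
            (A (Function.update q.2.1 r q.1) q.2.2.1 q.2.2.2).2 r) =
          G q.1 (chainState G pack R q.2.1 (x₀ q.2.2.1).1 (x₀ q.2.2.1).2 r)).card =
      Fintype.card Y * ((univ : Finset ((Fin (R + 1) → Y) × Ρ × Ω)).filter fun q => E r q.1 q.2.1 q.2.2).card := by
    intro r
    -- the planted predicate is `E r (ys[r ↦ y]) ρ ω` (the target state only uses the keys below `r`)
    have hcongr : ((univ : Finset (Y × (Fin (R + 1) → Y) × Ρ × Ω)).filter fun q =>
        chainState G pack R (Function.update q.2.1 r q.1) (A (Function.update q.2.1 r q.1) q.2.2.1 q.2.2.2).1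
            (A (Function.update q.2.1 r q.1) q.2.2.1 q.2.2.2).2 r ≠
          chainState G pack R q.2.1 (x₀ q.2.2.1).1 (x₀ q.2.2.1).2 r ∧
        G q.1 (chainState G pack R (Function.update q.2.1 r q.1) (A (Function.update q.2.1 r q.1) q.2.2.1 q.2.2.2).1
            (A (Function.update q.2.1 r q.1) q.2.2.1 q.2.2.2).2 r) =
          G q.1 (chainState G pack R q.2.1 (x₀ q.2.2.1).1 (x₀ q.2.2.1).2 r)) =
        ((univ : Finset (Y × (Fin (R + 1) → Y) × Ρ × Ω)).filter fun q =>
          E r (Function.update q.2.1 r q.1) q.2.2.1 q.2.2.2) := by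
      refine Finset.filter_congr fun q _ => ?_
      obtain ⟨y, ys, ρ, ω⟩ := q
      have hkeys : chainState G pack R ys (x₀ ρ).1 (x₀ ρ).2 r =
          chainState G pack R (Function.update ys r y) (x₀ ρ).1 (x₀ ρ).2 r :=
        chainState_congr G pack R _ _ fun i hi => by
          rw [Function.update_of_ne]
          exact fun h => absurd hi (by rw [h]; exact lt_irrefl _)
      simp only [hE, Function.update_self, hkeys]
    rw [hcongr, card_filter_plant r (fun ys (w : Ρ × Ω) => E r ys w.1 w.2)]
  calc _ ≤ (∑ r : Fin (R + 1), ((univ : Finset ((Fin (R + 1) → Y) × Ρ × Ω)).filter fun q => E r q.1 q.2.1 q.2.2).card) *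
        Fintype.card Y := Nat.mul_le_mul_right _ hcover
    _ = _ := by
        rw [Finset.sum_mul]
        exact Finset.sum_congr rfl fun r _ => by rw [hplant r, mul_comm]

end Chain

end HHRVW

end Literature.Computability.Cryptography
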